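import Literature.Computability.Complexity.BrainProtocol
import Literature.Computability.Complexity.DecisionTree
import HarnessLib

/-!
# Tree-walking brains: a `BrainProtocol` brain that follows a decision tree, and tables of pre-set bits

Topic `Literature/Computability/Complexity`, toolkit over `BrainProtocol.lean` (the oracle-driven
protocol machine: a brain `plan : List (List Bool × Bool) → Action` reads the probe results so
far and either probes a string of the second oracle or halts with a verdict) and
`DecisionTree.lean` (deterministic decision trees `DecisionTree M`, `eval`, `depth`).

**The brain of a decision tree.** Given a tree `t : DecisionTree M` over `M` Boolean variables
and names `var : Fin M → {0,1}*` for the variables, the brain `TreeBrain.plan var t` walks down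
`t`: having received the answers `b₁ … b_J` to its probes it stands at the node reached from the
root along these answers (`TreeBrain.descend`); at a query node of variable `i` it probes `var i`,
at a leaf it halts with the leaf's bit. On the canonical run of `BrainProtocol.lean` with true
answers `g` (so that the probe of `var i` is answered `g (var i) =: y i`) the brain stands, after
`J` probes, at the node reached by the input `y` in `J` steps (`descend_results_eq_follow`), hence
halts after at most `depth t` probes (`exists_halt`) with the verdict `t.eval y` (`verdict_eq`).
This is the classical half of "a polynomial-time machine evaluates a decision tree of polynomial
depth whose queries are spelled out by a powerful oracle" (Beals–Buhrman–Cleve–Mosca–de Wolf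
2001, §5, `D(f)`; Fenner–Fortnow–Kurtz–Li 2003, §6.3, the Standard Algorithm run by `P^{B ⊕ G}`
with `B` doing the thinking); the quantum/generic-oracle use is in
`QuantumComplexity/GenericBQPBrain.lean`.

**Tables.** `encodeTable`/`decodeTable` code a finite table of pre-set bits
`R₀ : List ({0,1}* × Bool)` (a Cohen condition handed to the brain in the payload) as one string
(`decodeTable_encodeTable`), and `condVal R₀ z` reads the bit of `z` off a table.

## References

* [BealsEtAl2001] R. Beals, H. Buhrman, R. Cleve, M. Mosca, R. de Wolf, *Quantum lower bounds by
  polynomials*, J. ACM 48 (2001), §5 (decision trees, `D(f)`).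
* [FennerFortnowKurtzLi2003IC] S. Fenner, L. Fortnow, S. Kurtz, L. Li, *An oracle builder's
  toolkit*, Inform. and Comput. 182 (2003), §6.3 (Fig. 1, the Standard Algorithm) and Lemma 6.17.
* [Wolf2002] H. Buhrman, R. de Wolf, *Complexity measures and decision tree complexity: a
  survey*, TCS 288 (2002), §2.1 (evaluation of a decision tree along an input).
-/

namespace Literature.Computability.Complexity

open BrainProtocol DecisionTree

/-! ### Tables of pre-set bits -/

/-- The bit the table `R` assigns to the string `z` (first entry wins), if any. [folklore] -/
def condVal (R : List (List Bool × Bool)) (z : List Bool) : Option Bool :=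
  (R.find? fun p => decide (p.1 = z)).map Prod.snd

/-- The empty table assigns nothing. [folklore] -/
@[simp] theorem condVal_nil (z : List Bool) : condVal [] z = none := rfl

/-- A value read off a table is an entry of the table. [folklore] -/
theorem mem_of_condVal_eq_some {R : List (List Bool × Bool)} {z : List Bool} {b : Bool}
    (h : condVal R z = some b) : (z, b) ∈ R := by
  unfold condVal at h
  cases hf : R.find? (fun p => decide (p.1 = z)) with
  | none => rw [hf] at h; cases h
  | some p =>
    rw [hf] at h
    obtain ⟨a, c⟩ := p
    have ha : a = z := by simpa using List.find?_some hf
    simp only [Option.map_some, Option.some.injEq] at h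
    subst ha; subst h
    exact List.mem_of_find?_eq_some hf

/-- A string absent from the table gets no value. [folklore] -/
theorem condVal_eq_none_of_forall_ne {R : List (List Bool × Bool)} {z : List Bool}
    (h : ∀ p ∈ R, p.1 ≠ z) : condVal R z = none := by
  unfold condVal
  rw [List.find?_eq_none.2 fun p hp => by simpa using h p hp]
  rfl

/-- The string coding a table: entry `(z, b)` becomes the block `⟨b z, rest⟩`. [folklore] -/
def encodeTable : List (List Bool × Bool) → List Bool
  | [] => []
  | (z, b) :: R => boolPair (b :: z) (encodeTable R)

/-- The coding of tables is injective. [folklore] -/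
theorem encodeTable_injective : Function.Injective encodeTable := by
  intro R
  induction R with
  | nil =>
    intro R' h
    cases R' with
    | nil => rfl
    | cons p R' =>
      obtain ⟨z, b⟩ := p
      have := congr_arg List.length h
      simp [encodeTable] at this
      omega
  | cons p R ih =>
    intro R' h
    obtain ⟨z, b⟩ := p
    cases R' with
    | nil =>
      have := congr_arg List.length h
      simp [encodeTable] at this
    | cons p' R' =>
      obtain ⟨z', b'⟩ := p'
      simp only [encodeTable] at h
      have h' := boolPair_injective (a₁ := (b :: z, encodeTable R)) (a₂ := (b' :: z', encodeTable R')) h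
      simp only [Prod.mk.injEq, List.cons.injEq] at h'
      obtain ⟨⟨rfl, rfl⟩, ht⟩ := h'
      rw [ih ht]

open Classical in
/-- Decoding a table (junk `[]` on strings that code no table). [folklore] -/
noncomputable def decodeTable (c : List Bool) : List (List Bool × Bool) :=
  if h : ∃ R, encodeTable R = c then h.choose else []

/-- Decoding inverts coding. [folklore] -/
@[simp] theorem decodeTable_encodeTable (R : List (List Bool × Bool)) : decodeTable (encodeTable R) = R := by
  unfold decodeTable
  have h : ∃ R', encodeTable R' = encodeTable R := ⟨R, rfl⟩
  rw [dif_pos h]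
  exact encodeTable_injective h.choose_spec

/-! ### Walking down a decision tree -/

namespace TreeBrain

variable {M : ℕ}

/-- The node reached from `t` by following the answer bits `bs` (a leaf absorbs all further
answers). [cite: Wolf2002, §2.1] -/
def descend : DecisionTree M → List Bool → DecisionTree M
  | t, [] => t
  | leaf v, _ :: _ => leaf v
  | query _ t₀ t₁, b :: bs => descend (if b then t₁ else t₀) bs

/-- One step down along the input `y`. [cite: Wolf2002, §2.1] -/
def stepDown (y : Fin M → Bool) : DecisionTree M → DecisionTree M
  | leaf v => leaf v
  | query i t₀ t₁ => if y i then t₁ else t₀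

/-- The node reached from `t` by the input `y` in `k` steps. [cite: Wolf2002, §2.1] -/
def follow (y : Fin M → Bool) (t : DecisionTree M) (k : ℕ) : DecisionTree M :=
  (stepDown y)^[k] t

/-- Descending along no answer stays put. [folklore] -/
@[simp] theorem descend_nil (t : DecisionTree M) : descend t [] = t := by
  cases t <;> rfl

/-- A leaf absorbs answers. [folklore] -/
@[simp] theorem descend_leaf (v : Bool) (bs : List Bool) : descend (leaf v : DecisionTree M) bs = leaf v := by
  cases bs <;> rfl

/-- Descending a query node along one more answer. [folklore] -/
@[simp] theorem descend_query_cons (i : Fin M) (t₀ t₁ : DecisionTree M) (b : Bool) (bs : List Bool) :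
    descend (query i t₀ t₁) (b :: bs) = descend (if b then t₁ else t₀) bs := rfl

/-- Descending along a concatenation is descending twice. [folklore] -/
theorem descend_append (t : DecisionTree M) (as bs : List Bool) :
    descend t (as ++ bs) = descend (descend t as) bs := by
  induction as generalizing t with
  | nil => simp
  | cons a as ih =>
    cases t with
    | leaf v => simp
    | query i t₀ t₁ => simp [ih]

/-- `follow` for `0` steps. [folklore] -/
@[simp] theorem follow_zero (y : Fin M → Bool) (t : DecisionTree M) : follow y t 0 = t := rfl

/-- `follow` for one more step. [folklore] -/
theorem follow_succ (y : Fin M → Bool) (t : DecisionTree M) (k : ℕ) :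
    follow y t (k + 1) = stepDown y (follow y t k) := by
  simp [follow, Function.iterate_succ_apply']

/-- Following the input does not change the value of the tree at that input. [cite: Wolf2002, §2.1] -/
theorem eval_follow (y : Fin M → Bool) (t : DecisionTree M) (k : ℕ) : (follow y t k).eval y = t.eval y := by
  induction k with
  | zero => rfl
  | succ k ih =>
    rw [follow_succ, ← ih]
    cases follow y t k with
    | leaf v => rfl
    | query i t₀ t₁ =>
      simp only [stepDown, eval_query]
      split <;> rfl

/-- After `k ≥ depth t` steps the input has reached a leaf. [cite: Wolf2002, §2.1] -/
theorem exists_follow_eq_leaf (y : Fin M → Bool) :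
    ∀ (t : DecisionTree M) (k : ℕ), t.depth ≤ k → ∃ v, follow y t k = leaf v
  | leaf v, k, _ => ⟨v, by
      induction k with
      | zero => rfl
      | succ k ih => rw [follow_succ, ih (Nat.zero_le _)]; rfl⟩
  | query i t₀ t₁, 0, h => by simp at h
  | query i t₀ t₁, k + 1, h => by
    have hk : (if y i then t₁ else t₀).depth ≤ k := by
      rw [depth_query] at h
      split
      · exact (le_max_right _ _).trans (Nat.le_of_succ_le_succ h)
      · exact (le_max_left _ _).trans (Nat.le_of_succ_le_succ h)
    obtain ⟨v, hv⟩ := exists_follow_eq_leaf y (if y i then t₁ else t₀) k hk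
    refine ⟨v, ?_⟩
    rw [← hv, follow, follow, Function.iterate_succ_apply]
    rfl

/-! ### The brain of a decision tree -/

variable (var : Fin M → List Bool) (t : DecisionTree M)

/-- **The brain of the tree `t`** with variable names `var`: standing at the node reached along
the answers received, probe the node's variable, or halt with the leaf's bit.
[cite: FennerFortnowKurtzLi2003IC, §6.3 (Fig. 1) and Lemma 6.17] [cite: BealsEtAl2001, §5] -/
def plan (R : List (List Bool × Bool)) : Action :=
  match descend t (R.map Prod.snd) with
  | leaf v => .halt v
  | query i _ _ => .probe (var i)

variable {var t}

/-- The brain halts with `v` iff it stands at the leaf `v`. [folklore] -/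
theorem plan_eq_halt_iff {R : List (List Bool × Bool)} {v : Bool} :
    plan var t R = .halt v ↔ descend t (R.map Prod.snd) = leaf v := by
  unfold plan
  split
  · rename_i v' h
    rw [h]
    constructor
    · intro h'; cases h'; rfl
    · intro h'; cases h'; rfl
  · rename_i i t₀ t₁ h
    rw [h]
    constructor
    · intro h'; cases h'
    · intro h'; cases h'

/-- The brain probes `z` iff it stands at a query node whose variable is named `z`. [folklore] -/
theorem plan_eq_probe_iff {R : List (List Bool × Bool)} {z : List Bool} :
    plan var t R = .probe z ↔ ∃ i t₀ t₁, descend t (R.map Prod.snd) = query i t₀ t₁ ∧ var i = z := by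
  unfold plan
  split
  · rename_i v' h
    rw [h]
    constructor
    · intro h'; cases h'
    · rintro ⟨i, t₀, t₁, h', -⟩; cases h'
  · rename_i i t₀ t₁ h
    rw [h]
    constructor
    · intro h'; cases h'; exact ⟨i, t₀, t₁, rfl, rfl⟩
    · rintro ⟨i', t₀', t₁', h', rfl⟩; cases h'; rfl

/-- Every probe is the name of a variable. [folklore] -/
theorem exists_eq_var_of_plan_eq_probe {R : List (List Bool × Bool)} {z : List Bool}
    (h : plan var t R = .probe z) : ∃ i, var i = z := by
  obtain ⟨i, -, -, -, hi⟩ := plan_eq_probe_iff.1 h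
  exact ⟨i, hi⟩

/-- **The canonical run walks the tree along the true answers**: after `J` probes answered by
`g`, the brain stands at the node reached in `J` steps by the input `y = g ∘ var`.
[cite: FennerFortnowKurtzLi2003IC, §6.3 (Fig. 1)] -/
theorem descend_results_eq_follow (g : List Bool → Bool) (J : ℕ) :
    descend t ((results (plan var t) g J).map Prod.snd) = follow (g ∘ var) t J := by
  induction J with
  | zero => simp [results]
  | succ J ih =>
    cases hp : plan var t (results (plan var t) g J) with
    | halt v =>
      rw [results_succ_of_halt g hp, ih, follow_succ]
      have hleaf : follow (g ∘ var) t J = leaf v := by rw [← ih]; exact plan_eq_halt_iff.1 hp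
      rw [hleaf]; rfl
    | probe z =>
      obtain ⟨i, t₀, t₁, hd, hz⟩ := plan_eq_probe_iff.1 hp
      rw [results_succ_of_probe g hp, List.map_append, descend_append, follow_succ, ← ih, hd]
      simp only [List.map_cons, List.map_nil, descend_query_cons, descend_nil, stepDown,
        Function.comp_apply, hz]

/-- **The brain halts within `depth t` probes.** [cite: BealsEtAl2001, §5 (D(f) = depth of an optimal tree)] -/
theorem exists_halt (g : List Bool → Bool) :
    ∃ J ≤ t.depth, ∃ v, plan var t (results (plan var t) g J) = .halt v := by
  obtain ⟨v, hv⟩ := exists_follow_eq_leaf (g ∘ var) t t.depth le_rfl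
  exact ⟨t.depth, le_rfl, v, plan_eq_halt_iff.2 (by rw [descend_results_eq_follow, hv])⟩

/-- **The halting verdict is the value of the tree** at the input `y = g ∘ var` read off the true
answers. [cite: Wolf2002, §2.1] [cite: FennerFortnowKurtzLi2003IC, §6.3 (Fig. 1)] -/
theorem verdict_eq (g : List Bool → Bool) {J : ℕ} {v : Bool}
    (h : plan var t (results (plan var t) g J) = .halt v) : v = t.eval (g ∘ var) := by
  have hd := plan_eq_halt_iff.1 h
  rw [descend_results_eq_follow] at hd
  have := eval_follow (g ∘ var) t J
  rw [hd, eval_leaf] at this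
  exact this

end TreeBrain

end Literature.Computability.Complexity
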